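import Literature.Analysis.SpecialFunctions.LogPiBounds
import Literature.NumberTheory.LFunctions.WeilFirstPrimeCertificateFacts
import HarnessLib

/-!
# First-prime Weil certificate with sharp constants

Topic: `Literature/NumberTheory/LFunctions`. The first-prime certificate `WeilCert2.check` of
`WeilFirstPrimeCertificate.lean` prices the three transcendental constants of the reduction with
the six/seven-digit rationals of the archimedean certificate (`invTwoPiHi = 1/(2·3.141592)` in the
matrix `P = Sym − q Ĝ` and in `κ`, `logPiHi = 1.1447299`); against a SIGNED minorant the price
`7 (q − q_lo) Σ_j bnd_j ‖g‖₂²` of `q − 1/(2π) ≈ 3.3·10⁻⁸` alone exceeds the margin (`≈ 5·10⁻⁸`) of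
the `a₀ = (log 3)/2` certificate. This file re-instantiates the checker with the constants as
PARAMETERS and then with the twenty-digit constants of `WeilSharpConstants.lean`:

* `WeilCert2.nuTabWith q` (the moment table rescaled by `q/invTwoPiHi`, so that the unchanged block
  machinery computes `Dᵀ rd(Sym − q Ĝ) D + κ(2 diag b − (b bᵀ) ∘ H')`, see `WeilCert.pmQ_nuScaled`),
  `kappaExactWith q qLo ℓ = wL − ℓ − 7 (q − qLo) Σ_j bnd_j − 2a₀(η_P + 5 q ν'_abs + (N+1)²/2^pg)`,
  `kappaQWith = rd(kappaExactWith)`, `checkScalarsWith`, `checkWith`;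
* soundness for ANY rationals `q ≥ 1/(2π) ≥ qLo`, `ℓ ≥ log π`:
  **`weilFirstPrimeQuadratic_nonneg_of_parts`** (hypotheses: the three constant inequalities, the
  cell facts `CellsFacts` of `WeilFirstPrimeCertificateFacts.lean`, `checkScalarsWith`, `checkNu`
  and the two parity blocks — the form a kernel evaluation in separate declarations produces) and
  **`weilFirstPrimeQuadratic_nonneg_of_checkWith`** (`checkWith q qLo ℓ = true`); the proof is the
  proof of `WeilCert2.weilFirstPrimeQuadratic_nonneg_of_check` with the constants abstracted;
* `log π` to twenty decimals as rationals, `logPiLoD20 ≤ log π ≤ logPiHiD20` (`logPi_mem_D20`, from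
  `Real.log_pi_gt_d20`, `Real.log_pi_lt_d20` of `Literature/Analysis/SpecialFunctions/LogPiBounds.lean`;
  the series bound `logPiHi20` of `WeilSharpConstants.lean` is good to `10⁻¹²` only);
* the twenty-digit instantiation `q = invTwoPiHi20`, `qLo = invTwoPiLo20` (`invTwoPiHi20_ge`,
  `invTwoPiLo20_le` of `WeilSharpConstants.lean`, width `< 10⁻²¹`), `ℓ = logPiHiD20`:
  `nuTab20`, `kappaQ20`, `checkScalars20`, `check20`, **`weilFirstPrimeQuadratic_nonneg_of_check20`**,
  **`weilFirstPrimeQuadratic_nonneg_of_parts20`**, `checkWith_intro` (the checker from its parts).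

Certificate format (unchanged): a `WeilCert2` = `WeilCert` base (`a0, N, T, wL, mwT, prec, pg`,
`CE, CO, DE, DO, UE, UO`; its `cells` unused) + first-prime cells `cells : List FPDCell` + support
`b` + the claimed moment table `nuData`. To certify first-prime positivity on `C(b)` with the sharp
constants, evaluate in the kernel: `checkCells₂ prec wL T mwT cells` (or prove `CellsFacts` by any
other cell checker), `checkScalars20`, `checkNu`, and for `p = 0, 1`, `i < nb` the rows
`base.checkDCRow p i`, `base.checkDomRow nuTab20 kappaQ20 p i` of `WeilBlockRows.lean`; then
`WeilCert.checkBlockK_of_rows` gives the two blocks `base.checkBlockK nuTab20 kappaQ20 p = true` and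
`weilFirstPrimeQuadratic_nonneg_of_parts20` (or `checkWith_intro` + `…_of_check20`) gives
`0 ≤ E₂(g)` on `C(b)`. Everything here is proved; no named facts.

## References

* H. Yoshida, *On Hermitian forms attached to zeta functions*, Adv. Stud. Pure Math. 21 (1992),
  §2 (2.1), §6, Theorem 1 (p. 310).
-/

noncomputable section

open Complex Finset MeasureTheory Set Filter
open scoped Real Topology ComplexConjugate BigOperators

namespace Literature.NumberTheory.LFunctions

/-! ## `log π` to twenty decimals, as rationals -/

/-- `1.14472988584940017414`, a rational lower bound of `log π` (`Real.log_pi_gt_d20` of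
`Literature/Analysis/SpecialFunctions/LogPiBounds.lean`). [folklore] -/
def logPiLoD20 : ℚ := 114472988584940017414 / 100000000000000000000

/-- `1.14472988584940017415`, a rational upper bound of `log π` (`Real.log_pi_lt_d20`). [folklore] -/
def logPiHiD20 : ℚ := 114472988584940017415 / 100000000000000000000

/-- **`logPiLoD20 ≤ log π ≤ logPiHiD20`** (two-sided, twenty decimals; use `.1` / `.2`). [folklore] -/
theorem logPi_mem_D20 :
    ((logPiLoD20 : ℚ) : ℝ) ≤ Real.log π ∧ Real.log π ≤ ((logPiHiD20 : ℚ) : ℝ) := by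
  have h1 := Literature.Analysis.SpecialFunctions.Real.log_pi_gt_d20
  have h2 := Literature.Analysis.SpecialFunctions.Real.log_pi_lt_d20
  have e1 : ((logPiLoD20 : ℚ) : ℝ) = 1.14472988584940017414 := by
    unfold logPiLoD20; push_cast; norm_num
  have e2 : ((logPiHiD20 : ℚ) : ℝ) = 1.14472988584940017415 := by
    unfold logPiHiD20; push_cast; norm_num
  rw [e1, e2]
  exact ⟨h1.le, h2.le⟩

/-- The width of the `log π` enclosure is `10⁻²⁰`. [folklore] -/
theorem logPiHiD20_sub_logPiLoD20 : logPiHiD20 - logPiLoD20 = 1 / 10 ^ 20 := by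
  unfold logPiHiD20 logPiLoD20; norm_num

/-- The width of the `1/(2π)` enclosure of `WeilSharpConstants.lean` is below `10⁻²¹`. [folklore] -/
theorem invTwoPiHi20_sub_invTwoPiLo20_lt : invTwoPiHi20 - invTwoPiLo20 < 1 / 10 ^ 21 := by
  unfold invTwoPiHi20 invTwoPiLo20 piLo20 piHi20; norm_num

namespace WeilCert2

variable (c : WeilCert2)

/-! ## The checker with the constants `q ≥ 1/(2π) ≥ qLo`, `ℓ ≥ log π` as parameters -/

/-- The moment table fed to the blocks for the constant `q`: `ν` rescaled by `q / invTwoPiHi`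
(`WeilCert.nuScaled`), so that `base.pmQ (nuTabWith q) = Sym − q Ĝ(ν)` (`pmQWith_cast`). [folklore] -/
def nuTabWith (q : ℚ) : List ℚ := c.base.nuScaled q c.nuTab

/-- The coefficient of `‖g‖₂²` after all reductions, before rounding, with the constants as
parameters: `wL − ℓ − 7 (q − qLo) Σ_j bnd_j − 2a₀ (η_P + 5 q ν'_abs + (N+1)²/2^pg)`. [folklore] -/
def kappaExactWith (q qLo lpHi : ℚ) : ℚ :=
  c.base.wL - lpHi - 7 * (q - qLo) * cellsBndSumQ c.base.wL c.cells -
    2 * c.base.a0 * (c.base.etaP + 5 * q * c.nuPrimeAbs + ((c.base.N : ℚ) + 1) ^ 2 / 2 ^ c.base.pg)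

/-- `κ = rd(κ_exact)`. [folklore] -/
def kappaQWith (q qLo lpHi : ℚ) : ℚ := ratRd c.base.pg (c.kappaExactWith q qLo lpHi)

/-- Scalar side conditions (`0 < b ≤ a₀ ≤ 1`, frequency cut-off vs `N`, Taylor remainder `≤ 1`,
even `N + 1`, `κ ≥ 0`) for the constants `q, qLo, ℓ`. [folklore] -/
def checkScalarsWith (q qLo lpHi : ℚ) : Bool :=
  decide (0 < c.b) && decide (c.b ≤ c.base.a0) && decide (c.base.a0 ≤ 1) && decide (0 < c.base.T) &&
    decide (2 * c.base.a0 * c.base.T ≤ (c.base.N : ℚ) + 2) &&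
    decide (2 * (c.base.a0 * c.base.T) ^ (c.base.N + 1) / (c.base.N + 1).factorial ≤ 1) &&
    decide (c.base.N + 1 = 2 * c.base.nb) && decide (0 ≤ c.kappaQWith q qLo lpHi)

/-- **The checker with the constants as parameters.** [folklore] -/
def checkWith (q qLo lpHi : ℚ) : Bool :=
  checkCells₂ c.base.prec c.base.wL c.base.T c.base.mwT c.cells && c.checkScalarsWith q qLo lpHi &&
    c.checkNu &&
    c.base.checkBlockK (c.nuTabWith q) (c.kappaQWith q qLo lpHi) 0 &&
    c.base.checkBlockK (c.nuTabWith q) (c.kappaQWith q qLo lpHi) 1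

/-! ## The twenty-digit instantiation -/

/-- The moment table for the blocks with `q = invTwoPiHi20`. [folklore] -/
def nuTab20 : List ℚ := c.nuTabWith invTwoPiHi20

/-- `κ` with the twenty-digit constants `invTwoPiHi20`, `invTwoPiLo20` (`WeilSharpConstants.lean`)
and `logPiHiD20`. [folklore] -/
def kappaQ20 : ℚ := c.kappaQWith invTwoPiHi20 invTwoPiLo20 logPiHiD20

/-- Scalar side conditions with the twenty-digit constants. [folklore] -/
def checkScalars20 : Bool := c.checkScalarsWith invTwoPiHi20 invTwoPiLo20 logPiHiD20

/-- **The checker with the twenty-digit constants** `q = invTwoPiHi20`, `qLo = invTwoPiLo20`,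
`ℓ = logPiHiD20`. [folklore] -/
def check20 : Bool := c.checkWith invTwoPiHi20 invTwoPiLo20 logPiHiD20

end WeilCert2

namespace WeilCert2

variable {c : WeilCert2}

/-- Unpacking `checkWith`. [folklore] -/
theorem checkWith_spec {q qLo lpHi : ℚ} (h : c.checkWith q qLo lpHi = true) :
    checkCells₂ c.base.prec c.base.wL c.base.T c.base.mwT c.cells = true ∧
      c.checkScalarsWith q qLo lpHi = true ∧ c.checkNu = true ∧
      c.base.checkBlockK (c.nuTabWith q) (c.kappaQWith q qLo lpHi) 0 = true ∧
      c.base.checkBlockK (c.nuTabWith q) (c.kappaQWith q qLo lpHi) 1 = true := by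
  unfold checkWith at h
  simp only [Bool.and_eq_true] at h
  exact ⟨h.1.1.1.1, h.1.1.1.2, h.1.1.2, h.1.2, h.2⟩

/-- Unpacking `checkScalarsWith`. [folklore] -/
theorem scalarsWith_spec {q qLo lpHi : ℚ} (h : c.checkScalarsWith q qLo lpHi = true) :
    0 < c.b ∧ c.b ≤ c.base.a0 ∧ c.base.a0 ≤ 1 ∧ 0 < c.base.T ∧
      2 * c.base.a0 * c.base.T ≤ (c.base.N : ℚ) + 2 ∧
      2 * (c.base.a0 * c.base.T) ^ (c.base.N + 1) / (c.base.N + 1).factorial ≤ 1 ∧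
      c.base.N + 1 = 2 * c.base.nb ∧ 0 ≤ c.kappaQWith q qLo lpHi := by
  unfold checkScalarsWith at h
  simp only [Bool.and_eq_true, decide_eq_true_eq] at h
  exact ⟨h.1.1.1.1.1.1.1, h.1.1.1.1.1.1.2, h.1.1.1.1.1.2, h.1.1.1.1.2, h.1.1.1.2, h.1.1.2, h.1.2, h.2⟩

/-- `checkWith` from its parts (the form produced by separate kernel evaluations). [folklore] -/
theorem checkWith_intro {q qLo lpHi : ℚ}
    (hcells : checkCells₂ c.base.prec c.base.wL c.base.T c.base.mwT c.cells = true)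
    (hsc : c.checkScalarsWith q qLo lpHi = true) (hnu : c.checkNu = true)
    (hb0 : c.base.checkBlockK (c.nuTabWith q) (c.kappaQWith q qLo lpHi) 0 = true)
    (hb1 : c.base.checkBlockK (c.nuTabWith q) (c.kappaQWith q qLo lpHi) 1 = true) :
    c.checkWith q qLo lpHi = true := by
  unfold checkWith
  simp only [Bool.and_eq_true]
  exact ⟨⟨⟨⟨hcells, hsc⟩, hnu⟩, hb0⟩, hb1⟩

/-- Entry identity for the table of the checker: `(pmQ (nuTabWith q) k l : ℝ) = Sym_{kl} − q Ĝ_{kl}`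
for `k, l ≤ N`. [folklore] -/
theorem pmQ_nuTabWith_cast (hnu : c.checkNu = true) (q : ℚ) {k l : ℕ} (hk : k < c.base.N + 1)
    (hl : l < c.base.N + 1) :
    ((c.base.pmQ (c.nuTabWith q) k l : ℚ) : ℝ) =
      (if k % 2 = l % 2 then
        (-1 : ℝ) ^ k * 2 * (((c.base.a0 : ℝ) / 2) ^ k / k.factorial) *
          (((c.base.a0 : ℝ) / 2) ^ l / l.factorial)
        else 0) -
      ((q : ℚ) : ℝ) * gHat c k l :=
  pmQWith_cast hnu q hk hl

/-! ## Soundness for arbitrary admissible constants -/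

set_option maxHeartbeats 1600000 in
/-- **Soundness of the first-prime certificate, constants as parameters, from the parts.**
For rationals `q ≥ 1/(2π) ≥ qLo` and `ℓ ≥ log π`, the cell facts, the scalar conditions, the moment
table check and the two parity blocks (on the table `nuTabWith q` with `κ = kappaQWith q qLo ℓ`)
imply: for every test function `g` with `tsupport g ⊆ [-b, b]`,
`0 ≤ 2 Re(ĝ(0) conj ĝ(1)) − (log π)‖g‖₂² + (1/2π) ∫ |ĝ(1/2+it)|² w₂(t) dt` (`= E₂(g)`). [folklore] -/
theorem weilFirstPrimeQuadratic_nonneg_of_parts {q qLo lpHi : ℚ}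
    (hqHi : 1 / (2 * π) ≤ ((q : ℚ) : ℝ)) (hqLo : ((qLo : ℚ) : ℝ) ≤ 1 / (2 * π))
    (hlp : Real.log π ≤ ((lpHi : ℚ) : ℝ))
    (hF : CellsFacts c.base.wL c.base.T c.cells) (hsc : c.checkScalarsWith q qLo lpHi = true)
    (hnuchk : c.checkNu = true)
    (hb0 : c.base.checkBlockK (c.nuTabWith q) (c.kappaQWith q qLo lpHi) 0 = true)
    (hb1 : c.base.checkBlockK (c.nuTabWith q) (c.kappaQWith q qLo lpHi) 1 = true)
    {g : ℝ → ℂ} (hg : IsWeilTest g) (hsupp : tsupport g ⊆ Icc (-(c.b : ℝ)) c.b) :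
    0 ≤ 2 * (weilMellin g 0 * conj (weilMellin g 1)).re - Real.log π * weilNorm2Sq g +
      1 / (2 * π) * ∫ t : ℝ, ‖weilMellin g (1 / 2 + t * I)‖ ^ 2 *
        (Literature.Analysis.SpecialFunctions.reDigammaQuarter t -
          Real.sqrt 2 * Real.log 2 * Real.cos (t * Real.log 2)) := by
  obtain ⟨hbpos, hba, ha1q, -, haT, hρT, hN, hκ⟩ := scalarsWith_spec hsc
  have ha0q : 0 < c.base.a0 := lt_of_lt_of_le hbpos hba
  set a : ℝ := (c.base.a0 : ℝ) with ha_def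
  have hba' : ((c.b : ℚ) : ℝ) ≤ a := by rw [ha_def]; exact_mod_cast hba
  have hb0' : (0 : ℝ) < c.b := by exact_mod_cast hbpos
  have ha : 0 < a := by linarith
  have ha1 : a ≤ 1 := by rw [ha_def]; exact_mod_cast ha1q
  have hsupp' : tsupport g ⊆ Icc (-a) a := hsupp.trans (Icc_subset_Icc (by linarith) hba')
  set n := c.base.N + 1 with hn
  set nu := c.nuTabWith q with hnu
  set M : ℕ → ℂ := weilMoment a g with hM
  set L := weilNorm1 g with hL
  set N2 := weilNorm2Sq g with hN2
  set z : ℕ → ℕ → ℝ := fun k l ↦ (conj (M k) * M l).re with hz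
  have hzsym : ∀ k l, z k l = z l k := fun k l ↦ by
    rw [hz]; simp only; rw [← WeilAna.re_mul_conj_eq, mul_comm]
  have hL0 : 0 ≤ L := weilNorm1_nonneg g
  have hN20 : 0 ≤ N2 := weilNorm2Sq_nonneg g
  have hL1 : L ^ 2 ≤ 2 * a * N2 := weilNorm1_sq_le hg ha hsupp'
  -- the three terms of E(g)
  set P : ℝ := 2 * (weilMellin g 0 * conj (weilMellin g 1)).re with hP
  set A : ℝ := ∫ t : ℝ, ‖weilMellin g (1 / 2 + t * I)‖ ^ 2 *
    (Literature.Analysis.SpecialFunctions.reDigammaQuarter t - Real.sqrt 2 * Real.log 2 * Real.cos (t * Real.log 2)) with hA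
  set Γ : ℝ := ∫ t : ℝ, ‖weilMellin g (1 / 2 + t * I)‖ ^ 2 * cellsGamma₂ c.base.wL c.cells t with hΓ
  -- Step A
  set ρ : ℝ := 2 * (a / 2) ^ (c.base.N + 1) / (c.base.N + 1).factorial with hρ
  have hρ0 : 0 ≤ ρ := by positivity
  have hPA : ∑ k ∈ range n, ∑ l ∈ range n,
      (2 * ((-a / 2) ^ k / k.factorial) * ((a / 2) ^ l / l.factorial)) * z k l -
      (8 * ρ + 6 * ρ ^ 2) * L ^ 2 ≤ P := WeilAna.polar_lower_bound hg ha ha1 hsupp' c.base.N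
  rw [WeilCert.polar_symmetrize n a z hzsym] at hPA
  -- Step B
  have hB : (c.base.wL : ℝ) * (2 * π * N2) - Γ ≤ A := arch_lower_bound_of_facts hF hg
  -- Step C
  have hC : Γ ≤ ∑ k ∈ range n, ∑ l ∈ range n, gHat c k l * z k l + 5 * L ^ 2 * (c.nuPrimeAbs : ℝ) := by
    have := freq_integral_bound_of_facts hF ha0q haT hρT hN hg (by rwa [← ha_def])
    rw [← ha_def] at this
    exact this
  -- constants
  set qR : ℝ := ((q : ℚ) : ℝ) with hqR
  set qLoR : ℝ := ((qLo : ℚ) : ℝ) with hqLoR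
  have hq1 : 1 / (2 * π) ≤ qR := hqHi
  have hpi : 0 < 1 / (2 * π) := by positivity
  have hq0 : 0 ≤ qR := hpi.le.trans hq1
  have hqLo1 : qLoR ≤ 1 / (2 * π) := hqLo
  have hlogpi : Real.log π ≤ ((lpHi : ℚ) : ℝ) := hlp
  have hν0 : 0 ≤ ((c.nuPrimeAbs : ℚ) : ℝ) := by
    have hev : Even (c.base.N + 1) := ⟨c.base.nb, by omega⟩
    have h1 : (0 : ℝ) ≤ (cellsAbsMomentQ c.base.wL c.cells (c.base.N + 1) : ℝ) :=
      hF.absMomentQ_nonneg hev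
    unfold nuPrimeAbs
    push_cast
    have ha0 : (0 : ℝ) ≤ (c.base.a0 : ℝ) := by rw [← ha_def]; exact ha.le
    positivity
  -- the signed `Γ`: `−(1/2π)Γ ≥ −qX − (q − qLo)·C₀·7·N2`
  set C₀ : ℝ := ((cellsBndSumQ c.base.wL c.cells : ℚ) : ℝ) with hC₀
  have hC₀0 : 0 ≤ C₀ := by rw [hC₀]; exact hF.bndSum_nonneg
  have hγabs : ∀ t, |cellsGamma₂ c.base.wL c.cells t| ≤ C₀ := fun t ↦ by
    rw [hC₀]; exact hF.abs_le t
  set ind : ℝ → ℝ := Set.indicator (Icc (-(c.base.T : ℝ)) c.base.T) (fun _ ↦ (1 : ℝ)) with hind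
  have hind01 : ∀ t, 0 ≤ ind t ∧ ind t ≤ 1 := fun t ↦ by
    rw [hind]; by_cases ht : t ∈ Icc (-(c.base.T : ℝ)) c.base.T
    · rw [Set.indicator_of_mem ht]; norm_num
    · rw [Set.indicator_of_notMem ht]; norm_num
  have hindm : Measurable ind := by rw [hind]; exact measurable_const.indicator measurableSet_Icc
  set PiT : ℝ := ∫ t : ℝ, ‖weilMellin g (1 / 2 + t * I)‖ ^ 2 * ind t with hPiT
  have hiPiT : Integrable fun t : ℝ ↦ ‖weilMellin g (1 / 2 + t * I)‖ ^ 2 * ind t :=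
    integrable_norm_sq_weilMellin_mul hg hindm (A := 1) (B := 0) zero_le_one le_rfl fun t ↦ by
      rw [zero_mul, add_zero, abs_of_nonneg (hind01 t).1]; exact (hind01 t).2
  obtain ⟨BΓ, hBΓ0, hBΓ⟩ := exists_abs_cellsGamma₂_le c.base.wL c.cells
  have hiΓ : Integrable fun t : ℝ ↦ ‖weilMellin g (1 / 2 + t * I)‖ ^ 2 * cellsGamma₂ c.base.wL c.cells t :=
    integrable_norm_sq_weilMellin_mul hg (measurable_cellsGamma₂ _ _) hBΓ0 le_rfl (B := 0)
      (fun t ↦ by simpa using hBΓ t)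
  have hPiT0 : 0 ≤ PiT := integral_nonneg fun t ↦ mul_nonneg (sq_nonneg _) (hind01 t).1
  have hPiTle : PiT ≤ 7 * N2 := by
    have h1 : PiT ≤ ∫ t : ℝ, ‖weilMellin g (1 / 2 + t * I)‖ ^ 2 :=
      integral_mono hiPiT (integrable_norm_sq_weilMellin_half_line hg) fun t ↦ by
        simpa using mul_le_mul_of_nonneg_left (hind01 t).2 (sq_nonneg ‖weilMellin g (1 / 2 + t * I)‖)
    rw [integral_norm_sq_weilMellin_half_line hg] at h1
    have h7 : 2 * π ≤ 7 := by linarith [Real.pi_lt_d2]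
    nlinarith
  -- `Γ₊ = Γ + C₀ PiT ≥ 0`
  have hΓplus : 0 ≤ Γ + C₀ * PiT := by
    rw [hΓ, hPiT, ← integral_const_mul, ← integral_add hiΓ (hiPiT.const_mul _)]
    refine integral_nonneg fun t ↦ ?_
    rw [show ‖weilMellin g (1 / 2 + t * I)‖ ^ 2 * cellsGamma₂ c.base.wL c.cells t +
        C₀ * (‖weilMellin g (1 / 2 + t * I)‖ ^ 2 * ind t) =
        ‖weilMellin g (1 / 2 + t * I)‖ ^ 2 * (cellsGamma₂ c.base.wL c.cells t + C₀ * ind t) by ring]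
    refine mul_nonneg (sq_nonneg _) ?_
    by_cases ht : t ∈ Icc (-(c.base.T : ℝ)) c.base.T
    · have : ind t = 1 := by rw [hind, Set.indicator_of_mem ht]
      rw [this, mul_one]
      linarith [neg_abs_le (cellsGamma₂ c.base.wL c.cells t), hγabs t]
    · have : ind t = 0 := by rw [hind, Set.indicator_of_notMem ht]
      have hT' : (c.base.T : ℝ) ≤ |t| := by
        rw [Set.mem_Icc, not_and_or, not_le, not_le] at ht
        rcases ht with ht | ht
        · linarith [neg_abs_le t, le_abs_self t, neg_le_abs t]
        · exact ht.le.trans (le_abs_self t)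
      rw [this, mul_zero, add_zero, hF.eq_zero hT']
  have hΓlow : -(qR * (∑ k ∈ range n, ∑ l ∈ range n, gHat c k l * z k l + 5 * L ^ 2 * (c.nuPrimeAbs : ℝ))) -
      (qR - qLoR) * C₀ * (7 * N2) ≤ -(1 / (2 * π) * Γ) := by
    have e : -(1 / (2 * π) * Γ) = -(1 / (2 * π)) * (Γ + C₀ * PiT) + 1 / (2 * π) * (C₀ * PiT) := by ring
    rw [e]
    have h1 : -qR * (Γ + C₀ * PiT) ≤ -(1 / (2 * π)) * (Γ + C₀ * PiT) := by nlinarith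
    have h2 : qLoR * (C₀ * PiT) ≤ 1 / (2 * π) * (C₀ * PiT) :=
      mul_le_mul_of_nonneg_right hqLo1 (mul_nonneg hC₀0 hPiT0)
    have h3 : qR * Γ ≤ qR * (∑ k ∈ range n, ∑ l ∈ range n, gHat c k l * z k l + 5 * L ^ 2 * (c.nuPrimeAbs : ℝ)) :=
      mul_le_mul_of_nonneg_left hC hq0
    have hqq : 0 ≤ qR - qLoR := by linarith
    have h4 : (qR - qLoR) * C₀ * PiT ≤ (qR - qLoR) * C₀ * (7 * N2) :=
      mul_le_mul_of_nonneg_left hPiTle (mul_nonneg hqq hC₀0)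
    nlinarith
  -- combine A, B, C
  have hB' : (c.base.wL : ℝ) * N2 - 1 / (2 * π) * Γ ≤ 1 / (2 * π) * A := by
    calc (c.base.wL : ℝ) * N2 - 1 / (2 * π) * Γ = 1 / (2 * π) * ((c.base.wL : ℝ) * (2 * π * N2) - Γ) := by
          field_simp
      _ ≤ 1 / (2 * π) * A := mul_le_mul_of_nonneg_left hB hpi.le
  have h5 : Real.log π * N2 ≤ ((lpHi : ℚ) : ℝ) * N2 := mul_le_mul_of_nonneg_right hlogpi hN20
  have step1 : ∑ k ∈ range n, ∑ l ∈ range n,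
      ((if k % 2 = l % 2 then
        (-1 : ℝ) ^ k * 2 * ((a / 2) ^ k / k.factorial) * ((a / 2) ^ l / l.factorial) else 0) -
        qR * gHat c k l) * z k l +
      ((c.base.wL : ℝ) - (lpHi : ℚ) - 7 * (qR - qLoR) * C₀) * N2 -
      ((8 * ρ + 6 * ρ ^ 2) + 5 * qR * (c.nuPrimeAbs : ℝ)) * L ^ 2 ≤ P - Real.log π * N2 + 1 / (2 * π) * A := by
    have e1 : ∑ k ∈ range n, ∑ l ∈ range n,
        ((if k % 2 = l % 2 then
          (-1 : ℝ) ^ k * 2 * ((a / 2) ^ k / k.factorial) * ((a / 2) ^ l / l.factorial) else 0) -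
          qR * gHat c k l) * z k l =
        ∑ k ∈ range n, ∑ l ∈ range n,
          (if k % 2 = l % 2 then
            (-1 : ℝ) ^ k * 2 * ((a / 2) ^ k / k.factorial) * ((a / 2) ^ l / l.factorial) else 0) * z k l -
        qR * ∑ k ∈ range n, ∑ l ∈ range n, gHat c k l * z k l := by
      rw [Finset.mul_sum, ← Finset.sum_sub_distrib]
      refine Finset.sum_congr rfl fun k _ ↦ ?_
      rw [Finset.mul_sum, ← Finset.sum_sub_distrib]
      refine Finset.sum_congr rfl fun l _ ↦ ?_
      ring
    rw [e1]
    linarith [hPA, hB', hΓlow, h5]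
  -- rewrite the matrix as `pmQ` on the rescaled table
  have step2 : ∑ k ∈ range n, ∑ l ∈ range n,
      ((if k % 2 = l % 2 then
        (-1 : ℝ) ^ k * 2 * ((a / 2) ^ k / k.factorial) * ((a / 2) ^ l / l.factorial) else 0) -
        qR * gHat c k l) * z k l =
      ∑ k ∈ range n, ∑ l ∈ range n, ((c.base.pmQ nu k l : ℚ) : ℝ) * z k l := by
    refine Finset.sum_congr rfl fun k hk ↦ Finset.sum_congr rfl fun l hl ↦ ?_
    rw [pmQ_nuTabWith_cast hnuchk q (Finset.mem_range.1 hk) (Finset.mem_range.1 hl)]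
  rw [step2] at step1
  -- rounding
  have hMk : ∀ k, ‖M k‖ ≤ L := fun k ↦ norm_weilMoment_le hg ha hsupp' k
  have hround : ∑ k ∈ range n, ∑ l ∈ range n, ((c.base.prQ nu k l : ℚ) : ℝ) * z k l -
      ∑ k ∈ range n, ∑ l ∈ range n, ((c.base.pmQ nu k l : ℚ) : ℝ) * z k l ≤
      1 / 2 ^ c.base.pg * (n : ℝ) ^ 2 * L ^ 2 :=
    WeilAlg.quad_rounding_le n (fun k l ↦ ((c.base.prQ nu k l : ℚ) : ℝ))
      (fun k l ↦ ((c.base.pmQ nu k l : ℚ) : ℝ)) (1 / 2 ^ c.base.pg) L (fun k l ↦ by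
        rw [abs_sub_comm]
        unfold WeilCert.prQ
        exact abs_cast_sub_ratRd_le c.base.pg (c.base.pmQ nu k l)) M hMk
  -- κ_exact
  have hcoef : 0 ≤ (8 * ρ + 6 * ρ ^ 2) + 5 * qR * (c.nuPrimeAbs : ℝ) + 1 / 2 ^ c.base.pg * (n : ℝ) ^ 2 :=
    add_nonneg (add_nonneg (by positivity) (mul_nonneg (mul_nonneg (by norm_num) hq0) hν0)) (by positivity)
  have hkex : ((c.kappaExactWith q qLo lpHi : ℚ) : ℝ) =
      ((c.base.wL : ℝ) - (lpHi : ℚ) - 7 * (qR - qLoR) * C₀) -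
        2 * a * ((8 * ρ + 6 * ρ ^ 2) + 5 * qR * (c.nuPrimeAbs : ℝ) + 1 / 2 ^ c.base.pg * (n : ℝ) ^ 2) := by
    rw [hρ, hqR, hqLoR, hC₀, hn, ha_def]
    unfold kappaExactWith WeilCert.etaP WeilCert.rhoE
    push_cast
    ring
  have hκle : ((c.kappaQWith q qLo lpHi : ℚ) : ℝ) ≤ ((c.kappaExactWith q qLo lpHi : ℚ) : ℝ) := by
    unfold kappaQWith; exact_mod_cast ratRd_le c.base.pg _
  have hκ0 : (0 : ℝ) ≤ ((c.kappaQWith q qLo lpHi : ℚ) : ℝ) := by exact_mod_cast hκ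
  -- E ≥ Σ pr z + κ N2
  have step3 : ∑ k ∈ range n, ∑ l ∈ range n, ((c.base.prQ nu k l : ℚ) : ℝ) * z k l +
      ((c.kappaQWith q qLo lpHi : ℚ) : ℝ) * N2 ≤ P - Real.log π * N2 + 1 / (2 * π) * A := by
    have h1 : ((c.kappaQWith q qLo lpHi : ℚ) : ℝ) * N2 ≤ ((c.kappaExactWith q qLo lpHi : ℚ) : ℝ) * N2 :=
      mul_le_mul_of_nonneg_right hκle hN20
    rw [hkex] at h1
    have h2 := mul_le_mul_of_nonneg_left hL1 hcoef
    linarith [step1, hround, h1, h2]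
  -- Bessel and the algebraic core
  have hbes : 2 * (∑ k ∈ range n, conj (c.base.uVec M k) * M k).re -
      (∑ k ∈ range n, ∑ l ∈ range n, conj (c.base.uVec M k) * c.base.uVec M l * (gramH a k l : ℂ)).re ≤ N2 :=
    weilNorm2Sq_ge_bessel hg ha hsupp' n (c.base.uVec M)
  have hcore : 0 ≤ (∑ k ∈ range n, ∑ l ∈ range n, ((c.base.prQ nu k l : ℚ) : ℝ) * z k l) +
      ((c.kappaQWith q qLo lpHi : ℚ) : ℝ) *
        (2 * (∑ k ∈ range n, conj (c.base.uVec M k) * M k).re -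
          (∑ k ∈ range n, ∑ l ∈ range n,
            conj (c.base.uVec M k) * c.base.uVec M l * (gramH a k l : ℂ)).re) := by
    have := WeilCert.core_nonnegK (c := c.base) (nu := nu) (κ := c.kappaQWith q qLo lpHi) hN hb0 hb1 a
      ha_def.symm M
    rw [← hn] at this
    exact this
  have h4 := mul_le_mul_of_nonneg_left hbes hκ0
  linarith [step3, h4, hcore]

/-- **Soundness of the first-prime certificate, constants as parameters.** If
`c.checkWith q qLo ℓ = true` for rationals `q ≥ 1/(2π) ≥ qLo`, `ℓ ≥ log π`, then `0 ≤ E₂(g)` for every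
test function `g` with `tsupport g ⊆ [-b, b]`. [folklore] -/
theorem weilFirstPrimeQuadratic_nonneg_of_checkWith {q qLo lpHi : ℚ}
    (hqHi : 1 / (2 * π) ≤ ((q : ℚ) : ℝ)) (hqLo : ((qLo : ℚ) : ℝ) ≤ 1 / (2 * π))
    (hlp : Real.log π ≤ ((lpHi : ℚ) : ℝ)) (h : c.checkWith q qLo lpHi = true)
    {g : ℝ → ℂ} (hg : IsWeilTest g) (hsupp : tsupport g ⊆ Icc (-(c.b : ℝ)) c.b) :
    0 ≤ 2 * (weilMellin g 0 * conj (weilMellin g 1)).re - Real.log π * weilNorm2Sq g +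
      1 / (2 * π) * ∫ t : ℝ, ‖weilMellin g (1 / 2 + t * I)‖ ^ 2 *
        (Literature.Analysis.SpecialFunctions.reDigammaQuarter t -
          Real.sqrt 2 * Real.log 2 * Real.cos (t * Real.log 2)) := by
  obtain ⟨hcells, hsc, hnu, hb0, hb1⟩ := checkWith_spec h
  exact weilFirstPrimeQuadratic_nonneg_of_parts hqHi hqLo hlp (cellsFacts_of_checkCells₂ hcells) hsc hnu
    hb0 hb1 hg hsupp

/-! ## Soundness of the twenty-digit instantiation -/

/-- **Soundness of `check20` from its parts** (cell facts from any cell checker, the scalar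
conditions, the moment table check, and the two parity blocks on `nuTab20` with `κ = kappaQ20`):
`0 ≤ E₂(g)` on `C(b)`. [folklore] -/
theorem weilFirstPrimeQuadratic_nonneg_of_parts20 (hF : CellsFacts c.base.wL c.base.T c.cells)
    (hsc : c.checkScalars20 = true) (hnu : c.checkNu = true)
    (hb0 : c.base.checkBlockK c.nuTab20 c.kappaQ20 0 = true)
    (hb1 : c.base.checkBlockK c.nuTab20 c.kappaQ20 1 = true)
    {g : ℝ → ℂ} (hg : IsWeilTest g) (hsupp : tsupport g ⊆ Icc (-(c.b : ℝ)) c.b) :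
    0 ≤ 2 * (weilMellin g 0 * conj (weilMellin g 1)).re - Real.log π * weilNorm2Sq g +
      1 / (2 * π) * ∫ t : ℝ, ‖weilMellin g (1 / 2 + t * I)‖ ^ 2 *
        (Literature.Analysis.SpecialFunctions.reDigammaQuarter t -
          Real.sqrt 2 * Real.log 2 * Real.cos (t * Real.log 2)) :=
  weilFirstPrimeQuadratic_nonneg_of_parts invTwoPiHi20_ge invTwoPiLo20_le logPi_mem_D20.2 hF hsc hnu hb0 hb1
    hg hsupp

/-- **Soundness of the twenty-digit first-prime certificate.** If `c.check20 = true` then for every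
test function `g` with `tsupport g ⊆ [-b, b]`,
`0 ≤ 2 Re(ĝ(0) conj ĝ(1)) − (log π)‖g‖₂² + (1/2π) ∫ |ĝ(1/2+it)|² w₂(t) dt` (`= E₂(g)`; for
`b ≤ (log 3)/2` this is `Re W(g ⋆ g̃)`, `weilQuadratic_re_eq_weilFirstPrimeQuadratic`). [folklore] -/
theorem weilFirstPrimeQuadratic_nonneg_of_check20 (h : c.check20 = true) {g : ℝ → ℂ}
    (hg : IsWeilTest g) (hsupp : tsupport g ⊆ Icc (-(c.b : ℝ)) c.b) :
    0 ≤ 2 * (weilMellin g 0 * conj (weilMellin g 1)).re - Real.log π * weilNorm2Sq g +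
      1 / (2 * π) * ∫ t : ℝ, ‖weilMellin g (1 / 2 + t * I)‖ ^ 2 *
        (Literature.Analysis.SpecialFunctions.reDigammaQuarter t -
          Real.sqrt 2 * Real.log 2 * Real.cos (t * Real.log 2)) :=
  weilFirstPrimeQuadratic_nonneg_of_checkWith invTwoPiHi20_ge invTwoPiLo20_le logPi_mem_D20.2 h hg hsupp

/-- The sharp `κ` dominates the six-digit one termwise in the constants: `kappaExactWith` is
antitone in `q` and `ℓ` and monotone in `qLo` (for `Σ_j bnd_j ≥ 0`, `ν'_abs ≥ 0`, `a₀ ≥ 0`). In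
particular sharper constants can only increase `κ`. [folklore] -/
theorem kappaExactWith_mono {q q' qLo qLo' lpHi lpHi' : ℚ} (hq : q' ≤ q) (hqLo : qLo ≤ qLo')
    (hlp : lpHi' ≤ lpHi) (hbnd : 0 ≤ cellsBndSumQ c.base.wL c.cells) (hν : 0 ≤ c.nuPrimeAbs)
    (ha : 0 ≤ c.base.a0) :
    c.kappaExactWith q qLo lpHi ≤ c.kappaExactWith q' qLo' lpHi' := by
  unfold kappaExactWith
  have h1 : 7 * (q' - qLo') * cellsBndSumQ c.base.wL c.cells ≤ 7 * (q - qLo) * cellsBndSumQ c.base.wL c.cells :=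
    mul_le_mul_of_nonneg_right (by linarith) hbnd
  have h2 : 2 * c.base.a0 * (c.base.etaP + 5 * q' * c.nuPrimeAbs + ((c.base.N : ℚ) + 1) ^ 2 / 2 ^ c.base.pg) ≤
      2 * c.base.a0 * (c.base.etaP + 5 * q * c.nuPrimeAbs + ((c.base.N : ℚ) + 1) ^ 2 / 2 ^ c.base.pg) :=
    mul_le_mul_of_nonneg_left (by nlinarith) (by positivity)
  linarith

end WeilCert2

end Literature.NumberTheory.LFunctions
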